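import Literature.NumberTheory.EllipticCurves.KubertTateThirteen
import HarnessLib

/-!
# A rational point of order `16` gives a non-cuspidal point of `X₁(16) : y² = x(x² + 1)(x² + 2x - 1)`

Topic `NumberTheory/EllipticCurves`; continues `Literature.NumberTheory.EllipticCurves.KubertTateThirteen`
(Tate normal form `E(b, c) : y² + (1 - c)xy - by = x³ - bx²` with marked point `P = (0, 0)`,
Sutherland's chart `b = rs(r - 1)`, `c = s(r - 1)`, and `4P = (r(r - 1), r²(r - 1)(s - 1))`).
Everything here is PROVED; the file introduces no definition and no named fact. It is the
generic-field half of the leaf `n = 16` of Mazur's "First reduction" (`Mazur1977_reduction_to_primes`,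
file `MazurTorsion`: no rational point of order `16`, Kubert 1976, Ch. IV, `X₁(16)(ℚ)` is cuspidal);
the arithmetic half (the rational points of the genus-`2` curve below) is the sibling proofs file
`KubertSixteenProofs`. HONEST FRAMING: this realises the modular parametrisation step of Kubert's
argument for `N = 16`; it does not prove Mazur's theorem, and the leaves `18, 25, 35, 49` of the
reduction stay open.

## The argument (over an arbitrary field `F`, `[DecidableEq F]`)

Let `P` be a point of order `16` on a Weierstrass cubic `V/F` and `Q = 2P` (order `8`).
(1) Tate normal form at `Q` (`exists_variableChange_pointEquiv_eq_zero`, Knapp §V.5):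
`V(F) ≃+ E(b, c)(F)` with `Q ↦ (0, 0)`, `P ↦ (x₀, y₀)`, `2·(x₀, y₀) = (0, 0)`. (2) Order `8` forces
Sutherland's raw form `F₈ = rs - 2r + 1 = 0` in the chart `b = rs(r-1)`, `c = s(r-1)`
(`exists_eq_of_addOrderOf_zero_eq_eight`: `4·(0,0) = (r(r-1), r²(r-1)(s-1))` is `2`-torsion iff
`r(r-1)(rs - 2r + 1) = 0`), so `b = (2r-1)(r-1)`, `c = (2r-1)(r-1)/r`, `4·(0,0) = (r(r-1), r(r-1)²)`.
(3) Halving (`kubertTate_Φ_two_eq_zero_of_add_self_eq`): the duplication formula (Silverman,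
*AEC*, III.2.3(d)) at `x(2·(x₀, y₀)) = 0` gives `Φ₂(x₀) = x₀⁴ + b(1-c)x₀² - 2b²x₀ + b³ = 0`.
(4) The key identity (`exists_X1SixteenQuintic_of_eq_zero`): with `A = r x₀² + r(1-2r)(1-r)²`,
`B = (1-2r)(x₀ + r - r²)` (`≠ 0` as `x₀ ≠ x(4·(0,0))`), `A² - r(1-r)B² = r²·Φ₂(x₀)`, so `σ := A/B`
has `σ² = r(1-r)` (the genus-`0` quotient `X₁(16)/⟨9⟩` of Bruin–Najman), `w := 2r x₀ - σ(1-2r)`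
has `w² = r(1-r)(1-2r)(4r² - 6r + 1 + 4rσ)`, and `x := (r - σ)/(r + σ)`,
`y := 2wr²/(σ(σ-r)(σ+r)³)` satisfy **`y² = x(x² + 1)(x² + 2x - 1)`**, `x ∉ {0, 1, -1}` (given
`2 ≠ 0`). In `u = σ/r` the intermediate curve is `v² = (u²+1)(u²-1)(u²+2u-1)`, the completed
square of Sutherland's `X₁(16) : v² - (u³ + u² - u + 1)v + u² = 0` (Bruin–Najman 2017, §2);
`x = (1-u)/(1+u)` gives the quintic form, whose six rational points `∞, (0,0), (±1, ±2)` are the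
six rational cusps. (5) `exists_X1Sixteen_point_of_addOrderOf_eq_sixteen` assembles (1)–(4).
All polynomial identities were found with exact computer algebra and are certified by
`ring` / `linear_combination`.

## References

* [Kubert1976] D. S. Kubert, *Universal bounds on the torsion of elliptic curves*, Proc. London
  Math. Soc. (3) 33 (1976) 193–237, Ch. IV (`X₁(16)(ℚ)` is cuspidal; `2`-power torsion).
* [Mazur1977] B. Mazur, *Modular curves and the Eisenstein ideal*, Publ. Math. IHÉS 47 (1977),
  Ch. III §5 p. 156 (First reduction), Thm. (7') p. 35.
* [Sutherland2012] A. V. Sutherland, *Constructing elliptic curves over finite fields with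
  prescribed torsion*, Math. Comp. 81 (2012) 1131–1147, §2 (raw forms; Table "`F_N(r,s)`",
  `N = 8`: `rs - 2r + 1`; Table "`f_N(x,y)`", `N = 16`).
* [BruinNajman2017] P. Bruin, F. Najman, *Fields of definition of elliptic curves with prescribed
  torsion*, Acta Arith. 181 (2017) 85–95, §2 (the model `X₁(16) : v² - (u³+u²-u+1)v + u² = 0`,
  genus `2`, and its genus-`0` quotient by `⟨9⟩`; held text arXiv:1607.05394 p. 4).
* [SilvermanAEC2009] J. H. Silverman, *The Arithmetic of Elliptic Curves*, 2nd ed., III.2.3(d).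
* [Knapp1993] A. W. Knapp, *Elliptic Curves*, §V.5 pp. 146–147 (Tate normal form).

## Design choices

As in `KubertTateThirteen.lean`: dot-notation-style extension of Mathlib's `WeierstrassCurve`
namespace, general field with `[DecidableEq F]`; no polynomial is introduced as a definition; all
non-degeneracy (`c ≠ 0`, `b ≠ c`, `x₀ ≠ x(4Q)`, `σ ≠ ±r`) is derived from `addOrderOf P = 16`.
-/

noncomputable section

namespace WeierstrassCurve

/-- In an additive group, `(k+1)·P = ±P` forces `k·P = 0` or `(k+2)·P = 0`. [folklore] -/
private theorem nsmul_eq_zero_or_of_eq_or_eq_neg₁₆ {A : Type*} [AddGroup A] (P : A) (k : ℕ)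
    (h : (k + 1) • P = P ∨ (k + 1) • P = -P) : k • P = 0 ∨ (k + 2) • P = 0 := by
  rcases h with h | h
  · left
    rwa [succ_nsmul, add_eq_right] at h
  · right
    rw [succ_nsmul] at h
    rw [show k + 2 = k + 1 + 1 from rfl, succ_nsmul, succ_nsmul, h, neg_add_cancel]

section Field

variable {F : Type*} [Field F] [DecidableEq F]

omit [DecidableEq F] in
/-- Transport of an affine point along equalities of its coordinates. [folklore] -/
private theorem some_eq_some_of_coord_eq₁₆ {W : WeierstrassCurve F} {x y x' y' : F}
    (h : W.toAffine.Nonsingular x y) (hx : x = x') (hy : y = y') :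
    ∃ h', (Affine.Point.some x y h : W.toAffine.Point) = Affine.Point.some x' y' h' := by
  subst hx hy
  exact ⟨h, rfl⟩

omit [DecidableEq F] in
/-- A nonzero point is an affine point. [folklore] -/
private theorem exists_eq_some_of_ne_zero₁₆ {W : WeierstrassCurve F} (P : W.toAffine.Point)
    (hP : P ≠ 0) : ∃ (x y : F) (h : W.toAffine.Nonsingular x y), P = Affine.Point.some x y h := by
  rcases P with _ | @⟨x, y, h⟩
  · exact absurd rfl hP
  · exact ⟨x, y, h, rfl⟩

/-! ### Order `8`: the raw form `F₈ = rs - 2r + 1` -/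

/-- **A point `(0, 0)` of order `8` on `E(b, c)` forces `b = (2r - 1)(r - 1)`, `c = (2r - 1)(r - 1)/r`**
for some `r ∉ {0, 1, ½}`, with `4·(0, 0) = (r(r - 1), r(r - 1)²)` (the rational `2`-torsion point).
In Sutherland's chart `b = rs(r - 1)`, `c = s(r - 1)` (available since order `8` forces `c ≠ 0`,
`b ≠ c`), `8·(0,0) = 𝒪` says that `4·(0,0) = (r(r - 1), r²(r - 1)(s - 1))` is its own negative, i.e.
`r(r - 1)·(rs - 2r + 1) = 0`: Sutherland's raw form `F₈(r, s) = rs - 2r + 1` of `X₁(8)`, whence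
`s = (2r - 1)/r`. [cite: Sutherland2012, §2 Table "F_N(r,s)", N = 8] -/
theorem exists_eq_of_addOrderOf_zero_eq_eight {b c : F}
    (h₀ : (kubertTate b c).toAffine.Nonsingular 0 0)
    (h8 : addOrderOf (Affine.Point.some 0 0 h₀ : (kubertTate b c).toAffine.Point) = 8) :
    ∃ r : F, r ≠ 0 ∧ r ≠ 1 ∧ 2 * r - 1 ≠ 0 ∧ b = (2 * r - 1) * (r - 1) ∧
      c = (2 * r - 1) * (r - 1) / r ∧
      ∃ h₄, 4 • (Affine.Point.some 0 0 h₀ : (kubertTate b c).toAffine.Point) =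
        Affine.Point.some (r * (r - 1)) (r * (r - 1) ^ 2) h₄ := by
  have hb : b ≠ 0 := (kubertTate_nonsingular_zero_iff b c).mp h₀
  set P₀ : (kubertTate b c).toAffine.Point := Affine.Point.some 0 0 h₀ with hP₀
  have e2 := kubertTate_two_nsmul_zero b c h₀
  have e3 := kubertTate_three_nsmul_zero b c h₀
  have hdvd : ∀ k : ℕ, k • P₀ = 0 → 8 ∣ k := fun k hk =>
    h8 ▸ addOrderOf_dvd_of_nsmul_eq_zero hk
  -- `c ≠ 0`, else `x(3P) = x(P)`
  have hc : c ≠ 0 := by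
    intro hc
    rcases nsmul_eq_zero_or_of_eq_or_eq_neg₁₆ P₀ 2
      (by rw [hP₀, e3]; exact (Affine.Point.X_eq_iff (h₂ := h₀)).mp hc) with h | h
    · exact absurd (hdvd 2 h) (by norm_num)
    · exact absurd (hdvd 4 h) (by norm_num)
  -- `b ≠ c`, else `x(3P) = x(2P)`
  have hbc : b - c ≠ 0 := by
    intro hbc
    rcases (Affine.Point.X_eq_iff
      (h₁ := kubertTate_nonsingular_three b c hb)
      (h₂ := kubertTate_nonsingular_two b c hb)).mp (sub_eq_zero.mp hbc).symm with h | h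
    · rw [← e2, ← e3, succ_nsmul, add_eq_left] at h
      exact Affine.Point.some_ne_zero h₀ h
    · have h5 : 5 • P₀ = 0 := by
        rw [show (5 : ℕ) = 3 + 2 from rfl, add_nsmul, hP₀, e3, e2, h, neg_add_cancel]
      exact absurd (hdvd 5 h5) (by norm_num)
  -- pass to `(r, s)`
  obtain ⟨r, s, rfl, rfl⟩ := exists_kubertTate_param _ _ hc hbc
  have hs : s ≠ 0 := left_ne_zero_of_mul hc
  have hr₁' : r - 1 ≠ 0 := right_ne_zero_of_mul hc
  have hr₁ : r ≠ 1 := sub_ne_zero.mp hr₁'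
  have hr : r ≠ 0 := by rintro rfl; exact hb (by ring)
  -- `8P = 0`: `4P` is its own negative
  obtain ⟨h₄, e₄⟩ := kubertTate_four_nsmul_zero r s h₀ hr₁ hs
  have h80 : (8 : ℕ) • P₀ = 0 := h8 ▸ addOrderOf_nsmul_eq_zero P₀
  have h44 : 4 • P₀ + 4 • P₀ = 0 := by rw [← add_nsmul]; exact h80
  rw [hP₀, e₄] at h44
  have hneg := eq_neg_of_add_eq_zero_left h44
  rw [Affine.Point.neg_some] at hneg
  have hy := ((Affine.Point.some.injEq _ _ _ _ _ _).mp hneg).2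
  simp only [Affine.negY, kubertTate] at hy
  have key : r * (r - 1) * (r * s - 2 * r + 1) = 0 := by linear_combination hy
  have h8r : r * s - 2 * r + 1 = 0 := by
    rcases mul_eq_zero.mp key with h | h
    · exact absurd h (mul_ne_zero hr hr₁')
    · exact h
  have h2r : 2 * r - 1 ≠ 0 := by
    intro h
    have hrs : r * s = 0 := by linear_combination h8r + h
    rcases mul_eq_zero.mp hrs with h' | h'
    · exact hr h'
    · exact hs h'
  refine ⟨r, hr, hr₁, h2r, ?_, ?_, ?_⟩
  · linear_combination (r - 1) * h8r
  · rw [eq_div_iff hr]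
    linear_combination (r - 1) * h8r
  · obtain ⟨h₄', e'⟩ := some_eq_some_of_coord_eq₁₆ h₄ rfl
      (show r ^ 2 * (r - 1) * (s - 1) = r * (r - 1) ^ 2 by linear_combination r * (r - 1) * h8r)
    exact ⟨h₄', e₄.trans e'⟩

/-! ### Halving the marked point: the duplication quartic `Φ₂` -/

/-- **Halving `(0, 0)` on `E(b, c)`**: if an affine point `(x₀, y₀)` of the Tate normal form
satisfies `(x₀, y₀) + (x₀, y₀) = (0, 0)`, then `Φ₂(x₀) = x₀⁴ + b(1 - c)x₀² - 2b²x₀ + b³ = 0`. This is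
the duplication formula `x(2P)·Ψ₂²(x) = Φ₂(x) = x⁴ - b₄x² - 2b₆x - b₈` (Silverman, *AEC*, Group
Law Algorithm III.2.3(d)) for `a₁ = 1 - c`, `a₂ = a₃ = -b`, `a₄ = a₆ = 0`, where `b₄ = -b(1 - c)`,
`b₆ = b²`, `b₈ = -b³`, read at `x(2P) = 0`. [cite: SilvermanAEC2009, Group Law Algorithm III.2.3(d)] -/
theorem kubertTate_Φ_two_eq_zero_of_add_self_eq {b c x₀ y₀ : F}
    (h' : (kubertTate b c).toAffine.Nonsingular x₀ y₀)
    (h₀ : (kubertTate b c).toAffine.Nonsingular 0 0)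
    (h2 : (Affine.Point.some x₀ y₀ h' : (kubertTate b c).toAffine.Point) +
      Affine.Point.some x₀ y₀ h' = Affine.Point.some 0 0 h₀) :
    x₀ ^ 4 + b * (1 - c) * x₀ ^ 2 - 2 * b ^ 2 * x₀ + b ^ 3 = 0 := by
  have hy : y₀ ≠ (kubertTate b c).toAffine.negY x₀ y₀ := by
    intro hy
    rw [Affine.Point.add_self_of_Y_eq hy] at h2
    exact Affine.Point.some_ne_zero h₀ h2.symm
  rw [Affine.Point.add_self_of_Y_ne hy] at h2
  have hX := ((Affine.Point.some.injEq _ _ _ _ _ _).mp h2).1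
  have hD : 2 * y₀ + (1 - c) * x₀ - b ≠ 0 := by
    intro h0
    apply hy
    simp only [Affine.negY, kubertTate]
    linear_combination h0
  have hden : y₀ - (kubertTate b c).toAffine.negY x₀ y₀ = 2 * y₀ + (1 - c) * x₀ - b := by
    simp only [Affine.negY, kubertTate]
    ring
  have hnum : 3 * x₀ ^ 2 + 2 * (kubertTate b c).toAffine.a₂ * x₀ + (kubertTate b c).toAffine.a₄
      - (kubertTate b c).toAffine.a₁ * y₀ = 3 * x₀ ^ 2 - 2 * b * x₀ - (1 - c) * y₀ := by
    simp only [kubertTate]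
    ring
  have hL : ∀ L : F, (kubertTate b c).toAffine.addX x₀ x₀ L = L ^ 2 + (1 - c) * L + b - 2 * x₀ := by
    intro L
    simp only [Affine.addX, kubertTate]
    ring
  rw [hL, Affine.slope_of_Y_ne rfl hy, hden, hnum] at hX
  have e : ∀ L : F, (L ^ 2 + (1 - c) * L + b - 2 * x₀) * (2 * y₀ + (1 - c) * x₀ - b) ^ 2 =
      (L * (2 * y₀ + (1 - c) * x₀ - b)) ^ 2
        + (1 - c) * (L * (2 * y₀ + (1 - c) * x₀ - b)) * (2 * y₀ + (1 - c) * x₀ - b)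
        + (b - 2 * x₀) * (2 * y₀ + (1 - c) * x₀ - b) ^ 2 := fun L => by ring
  have hmul := e ((3 * x₀ ^ 2 - 2 * b * x₀ - (1 - c) * y₀) / (2 * y₀ + (1 - c) * x₀ - b))
  rw [hX, zero_mul, div_mul_cancel₀ _ hD] at hmul
  have heq : y₀ ^ 2 + (1 - c) * x₀ * y₀ - b * y₀ - (x₀ ^ 3 - b * x₀ ^ 2) = 0 := by
    have h := h'.1
    rw [Affine.equation_iff'] at h
    simp only [kubertTate] at h
    linear_combination h
  linear_combination -hmul + ((1 - c) ^ 2 - 4 * b + 8 * x₀) * heq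

/-! ### The key identity: from `Φ₂(x₀) = 0` to the quintic `y² = x(x² + 1)(x² + 2x - 1)` -/

omit [DecidableEq F] in
/-- **From the duplication quartic to `X₁(16)`**: let `2 ≠ 0` in `F`, `r ∉ {0, 1, ½}`,
`b = (2r - 1)(r - 1)`, `x₀ ≠ r(r - 1)` and
`r x₀⁴ + b(r - b)x₀² - 2rb²x₀ + rb³ = 0` (`= r·Φ₂(x₀)` for `E(b, b/r)`). With
`A = r x₀² + r(1-2r)(1-r)²`, `B = (1-2r)(x₀ + r - r²) ≠ 0`, the identity `A² - r(1-r)B² = r·(r Φ₂)`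
gives `σ = A/B` with `σ² = r(1 - r)` (Bruin–Najman's genus-`0` quotient `X₁(16)/⟨9⟩`), then
`w = 2r x₀ - σ(1 - 2r)` with `w² = r(1-r)(1-2r)(4r² - 6r + 1 + 4rσ)`, i.e. in `u = σ/r` a point of
`v² = (u² + 1)(u² - 1)(u² + 2u - 1)`, the completed square of Sutherland's
`X₁(16) : v² - (u³ + u² - u + 1)v + u² = 0`; finally `x = (r - σ)/(r + σ)` (`= (1-u)/(1+u)`),
`y = 2wr²/(σ(σ - r)(σ + r)³)` satisfy `y² = x(x² + 1)(x² + 2x - 1)` with `x ∉ {0, 1, -1}`.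
[cite: BruinNajman2017, §2 (equation of X₁(16) and its quotient by ⟨9⟩)] -/
theorem exists_X1SixteenQuintic_of_eq_zero (h2 : (2 : F) ≠ 0) {r b x₀ : F} (hr : r ≠ 0)
    (hr₁ : r ≠ 1) (h2r : 2 * r - 1 ≠ 0) (hb : b = (2 * r - 1) * (r - 1)) (hx : x₀ ≠ r * (r - 1))
    (hN : r * x₀ ^ 4 + b * (r - b) * x₀ ^ 2 - 2 * r * b ^ 2 * x₀ + r * b ^ 3 = 0) :
    ∃ x y : F, y ^ 2 = x * (x ^ 2 + 1) * (x ^ 2 + 2 * x - 1) ∧ x ≠ 0 ∧ x ≠ 1 ∧ x ≠ -1 := by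
  subst hb
  have h12r : 1 - 2 * r ≠ 0 := fun h => h2r (by linear_combination -h)
  have hB0 : (1 - 2 * r) * (x₀ + r - r ^ 2) ≠ 0 := by
    refine mul_ne_zero h12r ?_
    intro h
    apply hx
    linear_combination h
  -- `σ = A/B`, `σ² = r(1 - r)`
  obtain ⟨σ, hσdef⟩ : ∃ σ : F,
      σ = (r * x₀ ^ 2 + r * (1 - 2 * r) * (1 - r) ^ 2) / ((1 - 2 * r) * (x₀ + r - r ^ 2)) :=
    ⟨_, rfl⟩
  have hAB : r * x₀ ^ 2 + r * (1 - 2 * r) * (1 - r) ^ 2 = σ * ((1 - 2 * r) * (x₀ + r - r ^ 2)) := by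
    rw [hσdef, div_mul_cancel₀ _ hB0]
  have hσ : σ ^ 2 = r * (1 - r) := by
    have key : (r * x₀ ^ 2 + r * (1 - 2 * r) * (1 - r) ^ 2) ^ 2
        - r * (1 - r) * ((1 - 2 * r) * (x₀ + r - r ^ 2)) ^ 2
        = r * (r * x₀ ^ 4 + (2 * r - 1) * (r - 1) * (r - (2 * r - 1) * (r - 1)) * x₀ ^ 2
            - 2 * r * ((2 * r - 1) * (r - 1)) ^ 2 * x₀ + r * ((2 * r - 1) * (r - 1)) ^ 3) := by
      ring
    rw [hN, mul_zero, hAB] at key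
    have hk : ((1 - 2 * r) * (x₀ + r - r ^ 2)) ^ 2 * (σ ^ 2 - r * (1 - r)) = 0 := by
      linear_combination key
    rcases mul_eq_zero.mp hk with h | h
    · exact absurd h (pow_ne_zero 2 hB0)
    · linear_combination h
  -- `σ ≠ 0`, `σ ≠ ±r`
  have hr1 : 1 - r ≠ 0 := fun h => hr₁ (by linear_combination -h)
  have hσ0 : σ ≠ 0 := by
    intro h
    rw [h] at hσ
    exact mul_ne_zero hr hr1 (by linear_combination -hσ)
  have hσr : σ - r ≠ 0 := by
    intro h
    rw [show σ = r by linear_combination h] at hσ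
    have h' : r * (2 * r - 1) = 0 := by linear_combination hσ
    rcases mul_eq_zero.mp h' with h'' | h''
    · exact hr h''
    · exact h2r h''
  have hσr' : σ + r ≠ 0 := by
    intro h
    rw [show σ = -r by linear_combination h] at hσ
    have h' : r * (2 * r - 1) = 0 := by linear_combination hσ
    rcases mul_eq_zero.mp h' with h'' | h''
    · exact hr h''
    · exact h2r h''
  have hrσ : r - σ ≠ 0 := fun h => hσr (by linear_combination -h)
  have hrσ' : r + σ ≠ 0 := fun h => hσr' (by linear_combination h)
  -- `w`
  obtain ⟨w, hwdef⟩ : ∃ w : F, w = 2 * r * x₀ - σ * (1 - 2 * r) := ⟨_, rfl⟩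
  have hw : w ^ 2 = r * (1 - r) * (1 - 2 * r) * (4 * r ^ 2 - 6 * r + 1 + 4 * r * σ) := by
    rw [hwdef]
    linear_combination (4 * r) * hAB + (2 * r - 1) ^ 2 * hσ
  -- the point of the quintic
  refine ⟨(r - σ) / (r + σ), 2 * w * r ^ 2 / (σ * (σ - r) * (σ + r) ^ 3), ?_,
    div_ne_zero hrσ hrσ', ?_, ?_⟩
  · have hX1 : ((r - σ) / (r + σ)) ^ 2 + 1 = 2 * r / (r + σ) ^ 2 := by
      rw [div_pow, div_add_one (pow_ne_zero 2 hrσ'), div_left_inj' (pow_ne_zero 2 hrσ')]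
      linear_combination 2 * hσ
    have hX2 : ((r - σ) / (r + σ)) ^ 2 + 2 * ((r - σ) / (r + σ)) - 1 =
        2 * r * (2 * r - 1 - 2 * σ) / (r + σ) ^ 2 := by
      have e : ((r - σ) / (r + σ)) ^ 2 + 2 * ((r - σ) / (r + σ)) - 1 =
          ((r - σ) ^ 2 + 2 * (r - σ) * (r + σ) - (r + σ) ^ 2) / (r + σ) ^ 2 := by
        field_simp
      rw [e, div_left_inj' (pow_ne_zero 2 hrσ')]
      linear_combination (-2) * hσ
    have hY : (2 * w * r ^ 2 / (σ * (σ - r) * (σ + r) ^ 3)) ^ 2 =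
        4 * r ^ 2 * (r - σ) * (2 * r - 1 - 2 * σ) / (r + σ) ^ 5 := by
      rw [div_pow, div_eq_div_iff (pow_ne_zero 2 (mul_ne_zero (mul_ne_zero hσ0 hσr)
        (pow_ne_zero 3 hσr'))) (pow_ne_zero 5 hrσ')]
      linear_combination (4 * r ^ 4 * (r + σ) ^ 5) * hw
        + (4 * r ^ 2 * (r + σ) ^ 5 * (r * (1 - r)
            * (-10 * r ^ 3 - 2 * r ^ 2 * σ + 7 * r ^ 2 + 6 * r * σ ^ 2 - r - 2 * σ ^ 3 - σ ^ 2)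
            - (r + σ) * (r - σ) ^ 3 * (2 * r - 1 - 2 * σ))) * hσ
    rw [hX1, hX2, hY, div_mul_div_comm, div_mul_div_comm,
      div_eq_div_iff (pow_ne_zero 5 hrσ') (mul_ne_zero (mul_ne_zero hrσ' (pow_ne_zero 2 hrσ'))
        (pow_ne_zero 2 hrσ'))]
    ring
  · intro h
    rw [div_eq_one_iff_eq hrσ'] at h
    have h' : (2 : F) * σ = 0 := by linear_combination -h
    rcases mul_eq_zero.mp h' with h'' | h''
    · exact h2 h''
    · exact hσ0 h''
  · intro h
    rw [div_eq_iff hrσ'] at h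
    have h' : (2 : F) * r = 0 := by linear_combination h
    rcases mul_eq_zero.mp h' with h'' | h''
    · exact h2 h''
    · exact hr h''

/-! ### Assembly: a point of order `16` on any Weierstrass cubic -/

/-- **A rational point of order `16` yields a non-cuspidal point of `X₁(16)`.** Over any field `F`
with `2 ≠ 0`: if a Weierstrass cubic `V/F` has a (nonsingular) `F`-point `P` of order `16`, then
there are `x y : F` with `y² = x(x² + 1)(x² + 2x - 1)` and `x ∉ {0, 1, -1}`. (Tate normal form at
`Q = 2P`, the raw form `F₈`, the duplication quartic and the key identity above; the genus-`2`
curve is Sutherland's `X₁(16)` — Bruin–Najman 2017 §2 — in the coordinate `x = (1 - u)/(1 + u)`.)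
This is the modular-curve half of "no elliptic curve over `ℚ` has a rational point of order `16`"
(Kubert 1976, Ch. IV; Mazur 1977, Thm. (7')). [cite: Kubert1976, Ch. IV (X₁(16))] -/
theorem exists_X1Sixteen_point_of_addOrderOf_eq_sixteen (h2 : (2 : F) ≠ 0)
    {V : WeierstrassCurve F} (P : V.toAffine.Point) (h16 : addOrderOf P = 16) :
    ∃ x y : F, y ^ 2 = x * (x ^ 2 + 1) * (x ^ 2 + 2 * x - 1) ∧ x ≠ 0 ∧ x ≠ 1 ∧ x ≠ -1 := by
  have hdvd : ∀ k : ℕ, k • P = 0 → 16 ∣ k := fun k hk => h16 ▸ addOrderOf_dvd_of_nsmul_eq_zero hk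
  -- `Q = 2P` has order `8`
  have hQ8 : addOrderOf (2 • P) = 8 := by
    simpa [h16] using addOrderOf_nsmul_of_dvd (x := P) two_ne_zero (by rw [h16]; norm_num)
  have hQdvd : ∀ k : ℕ, k • (2 • P) = 0 → 8 ∣ k := fun k hk =>
    hQ8 ▸ addOrderOf_dvd_of_nsmul_eq_zero hk
  have hQ0 : 2 • P ≠ 0 := fun h => absurd (hdvd 2 h) (by norm_num)
  obtain ⟨xq, yq, hq, hQe⟩ := exists_eq_some_of_ne_zero₁₆ _ hQ0
  have hQ2 : 2 • (Affine.Point.some xq yq hq : V.toAffine.Point) ≠ 0 := fun h =>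
    absurd (hQdvd 2 (by rw [hQe]; exact h)) (by norm_num)
  have hQ3 : 3 • (Affine.Point.some xq yq hq : V.toAffine.Point) ≠ 0 := fun h =>
    absurd (hQdvd 3 (by rw [hQe]; exact h)) (by norm_num)
  -- Tate normal form at `Q`
  obtain ⟨b, c, C, hC, h₀, he⟩ := exists_variableChange_pointEquiv_eq_zero V hq hQ2 hQ3
  have heQ : Affine.Point.congrEquiv hC (VariableChange.pointEquiv V C (2 • P)) =
      Affine.Point.some 0 0 h₀ := by
    rw [hQe]
    exact he
  have hP₀8 : addOrderOf (Affine.Point.some 0 0 h₀ : (kubertTate b c).toAffine.Point) = 8 := by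
    rw [← heQ, AddEquiv.addOrderOf_eq, AddEquiv.addOrderOf_eq, hQ8]
  obtain ⟨r, hr, hr₁, h2r, hb, hc, h₄, e₄⟩ := exists_eq_of_addOrderOf_zero_eq_eight h₀ hP₀8
  have h80 : (8 : ℕ) • (Affine.Point.some 0 0 h₀ : (kubertTate b c).toAffine.Point) = 0 :=
    hP₀8 ▸ addOrderOf_nsmul_eq_zero _
  have h44 : 4 • (Affine.Point.some 0 0 h₀ : (kubertTate b c).toAffine.Point) +
      4 • Affine.Point.some 0 0 h₀ = 0 := by
    rw [← add_nsmul]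
    exact h80
  -- the image `P' = (x₀, y₀)` of `P`, with `P' + P' = (0, 0)`
  have hP'0 : Affine.Point.congrEquiv hC (VariableChange.pointEquiv V C P) ≠ 0 := by
    intro h
    have h' := congrArg addOrderOf h
    rw [AddEquiv.addOrderOf_eq, AddEquiv.addOrderOf_eq, h16, addOrderOf_zero] at h'
    exact absurd h' (by norm_num)
  obtain ⟨x₀, y₀, h', hP'e⟩ := exists_eq_some_of_ne_zero₁₆ _ hP'0
  have h2P' : (Affine.Point.some x₀ y₀ h' : (kubertTate b c).toAffine.Point) +
      Affine.Point.some x₀ y₀ h' = Affine.Point.some 0 0 h₀ := by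
    rw [← hP'e, ← two_nsmul, ← map_nsmul, ← map_nsmul, heQ]
  have hΦ := kubertTate_Φ_two_eq_zero_of_add_self_eq h' h₀ h2P'
  -- `x₀ ≠ x(4·(0,0))`, else `P' = ±4·(0,0)` and `(0,0) = P' + P' = 𝒪`
  have hx : x₀ ≠ r * (r - 1) := by
    intro hx
    rcases (Affine.Point.X_eq_iff (h₁ := h') (h₂ := h₄)).mp hx with h | h
    · rw [h, ← e₄, h44] at h2P'
      exact Affine.Point.some_ne_zero h₀ h2P'.symm
    · rw [h, ← e₄, ← neg_add, h44, neg_zero] at h2P'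
      exact Affine.Point.some_ne_zero h₀ h2P'.symm
  -- clear the denominator of `c = b/r` and conclude
  have hcr : c * r = b := by
    rw [hc, div_mul_cancel₀ _ hr, hb]
  have hN : r * x₀ ^ 4 + b * (r - b) * x₀ ^ 2 - 2 * r * b ^ 2 * x₀ + r * b ^ 3 = 0 := by
    linear_combination r * hΦ + (b * x₀ ^ 2) * hcr
  exact exists_X1SixteenQuintic_of_eq_zero h2 hr hr₁ h2r hb hx hN

end Field

end WeierstrassCurve

end
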